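import Mathlib.NumberTheory.Padics.Complex
import Mathlib.NumberTheory.Padics.RingHoms
import Mathlib.Data.Nat.Factorization.Basic
import Mathlib.Data.Nat.Choose.Dvd
import Mathlib.Analysis.SpecificLimits.Basic
import Literature.NumberTheory.EllipticCurves.TateCurve.DivisiblePoints
import Literature.NumberTheory.EllipticCurves.TateCurve.UniformizationSubfield
import HarnessLib

/-!
# [AbsTopIII] Rmk. 1.5.3 (ii), CM-free witness — ultrametric toolkit for finite-dimensional
# subfields of `ℚ̄_p`

Proof-only companion (no new definitions) of `AbsTopIII/KummerFaithful.lean` (abc-iut-L4-t1,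
p404026), second brick of our witness for the named fact `Rmk_1_5_3_ii`
(S. Mochizuki, *Topics in Absolute Anabelian Geometry III*, §1, Rmk. 1.5.3 (ii), manuscript p. 33:
"one may construct an example of a field which is torally Kummer-faithful, but not Kummer-faithful").
The witness is the Kummer tower `k = ℚ_p(p^{1/ℓ^∞}) ⊆ ℚ̄_p` (`KummerTowerNotKummerFaithfulProofs`);
proving that `k` is TORALLY Kummer-faithful comes down to elementary facts about a subfield
`S ⊆ ℚ̄_p = PadicAlgCl p` of FINITE degree over `ℚ_p`, for Mathlib's (spectral) norm `‖·‖` of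
`PadicAlgCl p`, which this file proves from scratch (Mathlib has no structure theory of such `S`):

* §1 `exists_norm_pow_eq_zpow` — discreteness of `‖S^×‖` (`‖z‖^d ∈ p^ℤ`, `d = [S:ℚ_p]!`, the tree's
  `exists_norm_pow_factorial_eq_zpow`), with the corollaries `norm_pow_le_inv_of_norm_lt_one` and
  `norm_eq_one_of_forall_exists_pow_eq` (an element with `p^k`-th roots in `S` for all `k` has
  norm `1`);
* §2 `linearIndependent_mul_of_norm`, `mul_le_finrank_of_norm` — the inequality `e · f ≤ [S : ℚ_p]`:
  elements `x_i` with pairwise distinct classes in `‖ℚ̄_p^×‖ / p^ℤ` times an "orthonormal" family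
  `y_j` are `ℚ_p`-linearly independent;
* §3 `exists_norm_sub_lt_one` — pigeonhole: among more than `p^{[S:ℚ_p]/e}` elements of the unit
  ball of `S` two are congruent modulo the maximal ideal (digit expansions along a maximal
  orthonormal family, `PadicInt.exists_mem_range`).

Everything is stated for elements of `PadicAlgCl p` lying in an `IntermediateField ℚ_[p] (PadicAlgCl p)`
(no structure on the subtype beyond Mathlib's), so that the sequel can move along a tower of such
subfields.  HONEST FRAMING: classical local arithmetic; OUR kernel proofs; nothing here bears on
[IUTchIII] Cor. 3.12. [cite: MochizukiAbsTopIII2015, Rmk 1.5.3 (ii) p.33]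
-/

noncomputable section

open scoped Classical

namespace Literature.AnabelianGeometry.AbsoluteAnabelian.AbsTopIII

open Literature.NumberTheory.EllipticCurves.TateCurve

variable (p : ℕ) [Fact p.Prime]

/-! ## §0. A strict ultrametric sum bound -/

/-- A strict ultrametric bound for finite sums: if every term has norm `< C` (`C > 0`) then so does
the sum. [cite: MochizukiAbsTopIII2015, Rmk 1.5.3 (ii) p.33] -/
theorem norm_sum_lt_of_forall_lt {ι : Type*} (s : Finset ι) (f : ι → PadicAlgCl p) {C : ℝ}
    (hC : 0 < C) (h : ∀ i ∈ s, ‖f i‖ < C) : ‖∑ i ∈ s, f i‖ < C := by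
  induction s using Finset.induction_on with
  | empty => simpa using hC
  | insert a s ha ih =>
    rw [Finset.sum_insert ha]
    refine lt_of_le_of_lt (IsUltrametricDist.norm_add_le_max _ _) (max_lt ?_ ?_)
    · exact h a (Finset.mem_insert_self a s)
    · exact ih fun i hi => h i (Finset.mem_insert_of_mem hi)

/-! ## §1. Discreteness of the value group of a finite-dimensional subfield -/

variable (S : IntermediateField ℚ_[p] (PadicAlgCl p))

/-- **Discreteness**: for a subfield `S ⊆ ℚ̄_p` of finite degree over `ℚ_p` there is `d ≥ 1` with
`‖z‖^d ∈ p^ℤ` for every `z ∈ S^×` (the tree's `exists_norm_pow_factorial_eq_zpow` for the subspace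
norm of `S`, which is the spectral norm). [cite: MochizukiAbsTopIII2015, Rmk 1.5.3 (ii) p.33] -/
theorem exists_norm_pow_eq_zpow [FiniteDimensional ℚ_[p] S] :
    ∃ d : ℕ, 0 < d ∧ ∀ z ∈ S, z ≠ 0 → ∃ m : ℤ, ‖z‖ ^ d = (p : ℝ) ^ m := by
  letI : NontriviallyNormedField S := IntermediateField.nontriviallyNormedField S
  refine ⟨(Module.finrank ℚ_[p] S).factorial, Nat.factorial_pos _, fun z hz hz0 => ?_⟩
  have hne : (⟨z, hz⟩ : S) ≠ 0 := fun h => hz0 (congrArg Subtype.val h)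
  obtain ⟨m, hm⟩ := exists_norm_pow_factorial_eq_zpow p (⟨z, hz⟩ : S) hne
  exact ⟨m, hm⟩

variable {p S}

/-- If `‖z‖ < 1` for `z ∈ S` then `‖z‖^d ≤ p⁻¹` (`d` as in `exists_norm_pow_eq_zpow`).
[cite: MochizukiAbsTopIII2015, Rmk 1.5.3 (ii) p.33] -/
theorem norm_pow_le_inv_of_norm_lt_one {d : ℕ} (hd : 0 < d)
    (hdisc : ∀ z ∈ S, z ≠ 0 → ∃ m : ℤ, ‖z‖ ^ d = (p : ℝ) ^ m) {z : PadicAlgCl p} (hz : z ∈ S)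
    (h : ‖z‖ < 1) : ‖z‖ ^ d ≤ (p : ℝ)⁻¹ := by
  have hp1 : (1 : ℝ) < p := by exact_mod_cast (Fact.out : p.Prime).one_lt
  by_cases hz0 : z = 0
  · rw [hz0, norm_zero, zero_pow hd.ne']
    positivity
  obtain ⟨m, hm⟩ := hdisc z hz hz0
  have hlt : (p : ℝ) ^ m < 1 := by
    rw [← hm]
    exact pow_lt_one₀ (norm_nonneg _) h hd.ne'
  have hm0 : m ≤ -1 := by
    have := (zpow_lt_one_iff_right₀ hp1).mp hlt
    omega
  rw [hm, ← zpow_neg_one]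
  exact zpow_le_zpow_right₀ hp1.le hm0

/-- **An element of `S^×` admitting a `p^k`-th root in `S` for every `k` has norm `1`**
(`‖x‖^d = p^m` with `p^k ∣ m` for all `k`). [cite: MochizukiAbsTopIII2015, Rmk 1.5.3 (ii) p.33] -/
theorem norm_eq_one_of_forall_exists_pow_eq {d : ℕ} (hd : 0 < d)
    (hdisc : ∀ z ∈ S, z ≠ 0 → ∃ m : ℤ, ‖z‖ ^ d = (p : ℝ) ^ m) {x : PadicAlgCl p} (hx : x ∈ S)
    (hx0 : x ≠ 0) (h : ∀ k : ℕ, ∃ z ∈ S, z ^ p ^ k = x) : ‖x‖ = 1 := by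
  have hp1 : (1 : ℝ) < p := by exact_mod_cast (Fact.out : p.Prime).one_lt
  have hp0 : (0 : ℝ) < p := by positivity
  obtain ⟨m, hm⟩ := hdisc x hx hx0
  suffices hm0 : m = 0 by
    rw [hm0, zpow_zero] at hm
    exact (pow_eq_one_iff_of_nonneg (norm_nonneg x) hd.ne').mp hm
  by_contra hm0
  obtain ⟨k, hk⟩ : ∃ k : ℕ, m.natAbs < p ^ k := ⟨m.natAbs, Nat.lt_pow_self (Fact.out : p.Prime).one_lt⟩
  obtain ⟨z, hzS, hz⟩ := h k
  have hz0 : z ≠ 0 := by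
    rintro rfl
    rw [zero_pow (pow_ne_zero k (Fact.out : p.Prime).ne_zero)] at hz
    exact hx0 hz.symm
  obtain ⟨m', hm'⟩ := hdisc z hzS hz0
  have key : ((p : ℝ) ^ m') ^ (p ^ k) = (p : ℝ) ^ m := by
    rw [← hm', ← hm, ← pow_mul, mul_comm, pow_mul, ← norm_pow, hz]
  rw [← zpow_natCast, ← zpow_mul] at key
  have hmm : m' * ((p ^ k : ℕ) : ℤ) = m := zpow_right_injective₀ hp0 hp1.ne' key
  have hdvd : p ^ k ∣ m.natAbs := by
    refine ⟨m'.natAbs, ?_⟩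
    rw [← hmm, Int.natAbs_mul, Int.natAbs_natCast, mul_comm]
  have hle : p ^ k ≤ m.natAbs := Nat.le_of_dvd (Int.natAbs_pos.mpr hm0) hdvd
  omega

/-! ## §2. The inequality `e · f ≤ [S : ℚ_p]` -/

/-- **Independence lemma**: if `x_1, …, x_e ∈ ℚ̄_p^×` have pairwise distinct classes in
`‖ℚ̄_p^×‖ / p^ℤ` and `y_1, …, y_f` (of norm `≤ 1`) are "orthonormal" — `‖Σ c_j y_j‖ ≥ ‖c_j‖` for all
`c ∈ ℚ_p^f` — then the products `x_i y_j` are `ℚ_p`-linearly independent (an ultrametric sum of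
terms of pairwise distinct norms is non-zero). [cite: MochizukiAbsTopIII2015, Rmk 1.5.3 (ii) p.33] -/
theorem linearIndependent_mul_of_norm {e f : ℕ} (x : Fin e → PadicAlgCl p)
    (y : Fin f → PadicAlgCl p) (hx0 : ∀ i, x i ≠ 0)
    (hx : ∀ i j, i ≠ j → ∀ m : ℤ, ‖x i‖ ≠ ‖x j‖ * (p : ℝ) ^ m)
    (hy1 : ∀ j, ‖y j‖ ≤ 1)
    (hy : ∀ c : Fin f → ℚ_[p], ∀ j, ‖c j‖ ≤ ‖∑ j', (c j' : PadicAlgCl p) * y j'‖) :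
    LinearIndependent ℚ_[p] (fun ij : Fin e × Fin f => x ij.1 * y ij.2) := by
  have hp0 : (0 : ℝ) < p := by exact_mod_cast (Fact.out : p.Prime).pos
  rw [Fintype.linearIndependent_iff]
  intro g hg
  -- the partial sums `s i = Σ_j g(i,j) y_j`
  set s : Fin e → PadicAlgCl p := fun i => ∑ j, (g (i, j) : PadicAlgCl p) * y j with hs
  have hsum : ∑ i, x i * s i = 0 := by
    rw [← hg, Fintype.sum_prod_type]
    refine Finset.sum_congr rfl fun i _ => ?_
    rw [Finset.mul_sum]
    refine Finset.sum_congr rfl fun j _ => ?_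
    rw [Algebra.smul_def, ← PadicAlgCl.coe_eq]
    ring
  -- each coefficient is bounded by the norm of its partial sum
  have hcoef : ∀ i j, ‖g (i, j)‖ ≤ ‖s i‖ := fun i j => hy (fun j => g (i, j)) j
  -- a non-zero partial sum has norm in `p^ℤ`
  have hnorm : ∀ i, s i ≠ 0 → ∃ m : ℤ, ‖s i‖ = (p : ℝ) ^ m := by
    intro i hi
    have hfne : (Finset.univ : Finset (Fin f)).Nonempty := by
      rw [Finset.univ_nonempty_iff]
      by_contra hf
      rw [not_nonempty_iff] at hf
      exact hi (Finset.sum_of_isEmpty _)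
    obtain ⟨j₀, -, hj₀⟩ := Finset.exists_max_image Finset.univ (fun j => ‖g (i, j)‖) hfne
    have hle : ‖s i‖ ≤ ‖g (i, j₀)‖ := by
      refine IsUltrametricDist.norm_sum_le_of_forall_le_of_nonneg (norm_nonneg _) fun j _ => ?_
      rw [norm_mul, PadicAlgCl.norm_extends]
      calc ‖g (i, j)‖ * ‖y j‖ ≤ ‖g (i, j)‖ * 1 := by gcongr; exact hy1 j
        _ ≤ ‖g (i, j₀)‖ := by rw [mul_one]; exact hj₀ j (Finset.mem_univ j)
    have heq : ‖s i‖ = ‖g (i, j₀)‖ := le_antisymm hle (hcoef i j₀)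
    have hg0 : g (i, j₀) ≠ 0 := by
      intro h0
      rw [h0, norm_zero] at heq
      exact hi (norm_eq_zero.mp heq)
    exact ⟨-(g (i, j₀)).valuation, by rw [heq, Padic.norm_eq_zpow_neg_valuation hg0]⟩
  -- all partial sums vanish
  have hs0 : ∀ i, s i = 0 := by
    by_contra hne
    push Not at hne
    set I₀ : Finset (Fin e) := Finset.univ.filter fun i => s i ≠ 0 with hI₀
    have hmemI₀ : ∀ i, i ∈ I₀ ↔ s i ≠ 0 := fun i => by simp [hI₀]
    have hI₀ne : I₀.Nonempty := by
      obtain ⟨i, hi⟩ := hne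
      exact ⟨i, (hmemI₀ i).mpr hi⟩
    have hsum' : ∑ i ∈ I₀, x i * s i = 0 := by
      rw [← hsum]
      refine Finset.sum_subset (Finset.filter_subset _ _) fun i _ hi => ?_
      have : s i = 0 := by simpa [hmemI₀] using hi
      rw [this, mul_zero]
    have hpair : Set.Pairwise (I₀ : Set (Fin e)) fun i j => ‖x i * s i‖ ≠ ‖x j * s j‖ := by
      intro i hi j hj hij h
      obtain ⟨mi, hmi⟩ := hnorm i ((hmemI₀ i).mp hi)
      obtain ⟨mj, hmj⟩ := hnorm j ((hmemI₀ j).mp hj)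
      rw [norm_mul, norm_mul, hmi, hmj] at h
      apply hx i j hij (mj - mi)
      rw [zpow_sub₀ hp0.ne', mul_div_assoc', ← h, mul_div_assoc, div_self (zpow_ne_zero _ hp0.ne'),
        mul_one]
    have key := IsUltrametricDist.norm_sum_eq_sup'_of_pairwise_ne hI₀ne hpair
    rw [hsum', norm_zero] at key
    obtain ⟨i, hi⟩ := hI₀ne
    have hxi0 : x i * s i ≠ 0 := mul_ne_zero (hx0 i) ((hmemI₀ i).mp hi)
    have hpos : 0 < ‖x i * s i‖ := norm_pos_iff.mpr hxi0
    have hle : ‖x i * s i‖ ≤ I₀.sup' ⟨i, hi⟩ fun i => ‖x i * s i‖ :=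
      Finset.le_sup' (fun i => ‖x i * s i‖) hi
    linarith
  -- hence all coefficients vanish
  rintro ⟨i, j⟩
  have h := hcoef i j
  rw [hs0 i, norm_zero] at h
  exact norm_eq_zero.mp (le_antisymm h (norm_nonneg _))

variable (p S) in
/-- **The inequality `e · f ≤ [S : ℚ_p]`** for the sizes of the two families of
`linearIndependent_mul_of_norm` inside `S`. [cite: MochizukiAbsTopIII2015, Rmk 1.5.3 (ii) p.33] -/
theorem mul_le_finrank_of_norm [FiniteDimensional ℚ_[p] S] {e f : ℕ} (x : Fin e → PadicAlgCl p)
    (y : Fin f → PadicAlgCl p) (hxS : ∀ i, x i ∈ S) (hyS : ∀ j, y j ∈ S) (hx0 : ∀ i, x i ≠ 0)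
    (hx : ∀ i j, i ≠ j → ∀ m : ℤ, ‖x i‖ ≠ ‖x j‖ * (p : ℝ) ^ m)
    (hy1 : ∀ j, ‖y j‖ ≤ 1)
    (hy : ∀ c : Fin f → ℚ_[p], ∀ j, ‖c j‖ ≤ ‖∑ j', (c j' : PadicAlgCl p) * y j'‖) :
    e * f ≤ Module.finrank ℚ_[p] S := by
  have hli := linearIndependent_mul_of_norm x y hx0 hx hy1 hy
  let v : Fin e × Fin f → S := fun ij => ⟨x ij.1 * y ij.2, mul_mem (hxS ij.1) (hyS ij.2)⟩
  have hv : LinearIndependent ℚ_[p] v := LinearIndependent.of_comp S.val.toLinearMap hli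
  simpa using hv.fintype_card_le_finrank

/-! ## §3. Pigeonhole modulo the maximal ideal -/

/-- A `p`-adic number of norm `≤ 1` is within distance `< 1` of a digit `a ∈ {0, …, p-1}`
(`ℤ_p / p ℤ_p = 𝔽_p`, Mathlib's `PadicInt.exists_mem_range`), also after the embedding in `ℚ̄_p`.
[cite: MochizukiAbsTopIII2015, Rmk 1.5.3 (ii) p.33] -/
theorem exists_digit_norm_sub_lt_one (c : ℚ_[p]) (hc : ‖c‖ ≤ 1) :
    ∃ a : ℕ, a < p ∧ ‖(c : PadicAlgCl p) - (a : PadicAlgCl p)‖ < 1 := by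
  set x : ℤ_[p] := ⟨c, hc⟩ with hx
  obtain ⟨a, ha, hmem⟩ := PadicInt.exists_mem_range x
  refine ⟨a, ha, ?_⟩
  have h1 : ‖x - (a : ℤ_[p])‖ < 1 :=
    PadicInt.mem_nonunits.mp ((IsLocalRing.mem_maximalIdeal _).mp hmem)
  have h2 : ‖(c : ℚ_[p]) - (a : ℚ_[p])‖ < 1 := by
    rw [PadicInt.norm_def, PadicInt.coe_sub, PadicInt.coe_natCast] at h1
    exact h1
  rw [← map_natCast (algebraMap ℚ_[p] (PadicAlgCl p)) a, ← map_sub, PadicAlgCl.norm_extends]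
  exact h2

variable (p S) in
/-- **Pigeonhole**: if `S` contains `e ≥ 1` non-zero elements with pairwise distinct classes in
`‖ℚ̄_p^×‖ / p^ℤ`, then among any `N > p^{[S:ℚ_p]/e}` elements of the unit ball of `S` two are at
distance `< 1` (digit expansion along a maximal orthonormal family, whose size `f` satisfies
`e · f ≤ [S : ℚ_p]`). [cite: MochizukiAbsTopIII2015, Rmk 1.5.3 (ii) p.33] -/
theorem exists_norm_sub_lt_one [FiniteDimensional ℚ_[p] S] {e : ℕ} (x : Fin e → PadicAlgCl p)
    (hxS : ∀ i, x i ∈ S) (hx0 : ∀ i, x i ≠ 0)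
    (hx : ∀ i j, i ≠ j → ∀ m : ℤ, ‖x i‖ ≠ ‖x j‖ * (p : ℝ) ^ m) (he : 0 < e)
    {N : ℕ} (g : Fin N → PadicAlgCl p) (hgS : ∀ i, g i ∈ S) (hg1 : ∀ i, ‖g i‖ ≤ 1)
    (hN : p ^ (Module.finrank ℚ_[p] S / e) < N) : ∃ i j, i ≠ j ∧ ‖g i - g j‖ < 1 := by
  set d := Module.finrank ℚ_[p] S with hd
  -- orthonormal families in the unit ball of `S`, and their size bound
  have hbound : ∀ (f : ℕ) (y : Fin f → PadicAlgCl p), (∀ j, y j ∈ S) → (∀ j, ‖y j‖ ≤ 1) →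
      (∀ c : Fin f → ℚ_[p], ∀ j, ‖c j‖ ≤ ‖∑ j', (c j' : PadicAlgCl p) * y j'‖) → f ≤ d / e := by
    intro f y hyS hy1 hy
    have := mul_le_finrank_of_norm p S x y hxS hyS hx0 hx hy1 hy
    exact (Nat.le_div_iff_mul_le he).mpr (by rw [mul_comm]; exact this)
  let P : ℕ → Prop := fun f => ∃ y : Fin f → PadicAlgCl p, (∀ j, y j ∈ S) ∧ (∀ j, ‖y j‖ ≤ 1) ∧
      ∀ c : Fin f → ℚ_[p], ∀ j, ‖c j‖ ≤ ‖∑ j', (c j' : PadicAlgCl p) * y j'‖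
  have hP0 : P 0 := ⟨Fin.elim0, fun j => j.elim0, fun j => j.elim0, fun c j => j.elim0⟩
  obtain ⟨f₀, hPf₀, hnot⟩ : ∃ f₀, P f₀ ∧ ¬ P (f₀ + 1) := by
    by_contra hall
    push Not at hall
    have hind : ∀ n, P n := fun n => Nat.rec hP0 (fun n hn => hall n hn) n
    obtain ⟨y, hyS, hy1, hy⟩ := hind (d / e + 1)
    have := hbound _ y hyS hy1 hy
    omega
  have hf₀le : f₀ ≤ d / e := by
    obtain ⟨y, hyS, hy1, hy⟩ := hPf₀
    exact hbound _ y hyS hy1 hy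
  obtain ⟨y, hyS, hy1, hy⟩ := hPf₀
  -- digit expansion of any element of the unit ball of `S` along `y`
  have hdigit : ∀ z ∈ S, ‖z‖ ≤ 1 → ∃ a : Fin f₀ → Fin p,
      ‖z - ∑ j, ((a j : ℕ) : PadicAlgCl p) * y j‖ < 1 := by
    intro z hzS hz1
    -- the extended family `(z, y)` is not orthonormal
    have hz : ∃ c : Fin (f₀ + 1) → ℚ_[p], ∃ j,
        ‖∑ j', (c j' : PadicAlgCl p) * (Fin.cons z y : Fin (f₀ + 1) → PadicAlgCl p) j'‖ < ‖c j‖ := by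
      by_contra hall
      push Not at hall
      exact hnot ⟨Fin.cons z y, fun j => Fin.cases hzS (fun j => hyS j) j,
        fun j => Fin.cases hz1 (fun j => hy1 j) j, hall⟩
    obtain ⟨c, j, hcj⟩ := hz
    set w := ∑ j', (c j' : PadicAlgCl p) * (Fin.cons z y : Fin (f₀ + 1) → PadicAlgCl p) j' with hw
    have hwsplit : w = (c 0 : PadicAlgCl p) * z + ∑ j, (c j.succ : PadicAlgCl p) * y j := by
      rw [hw, Fin.sum_univ_succ]
      simp only [Fin.cons_zero, Fin.cons_succ]
    obtain ⟨j₁, -, hj₁⟩ := Finset.exists_max_image Finset.univ (fun j => ‖c j‖)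
      ⟨j, Finset.mem_univ _⟩
    have hC : ‖w‖ < ‖c j₁‖ := lt_of_lt_of_le hcj (hj₁ j (Finset.mem_univ _))
    -- the coefficient of `z` has maximal norm
    have hc0 : ‖c 0‖ = ‖c j₁‖ := by
      refine le_antisymm (hj₁ 0 (Finset.mem_univ _)) ?_
      by_contra hlt
      push Not at hlt
      have hj₁0 : j₁ ≠ 0 := fun h => by rw [h] at hlt; exact lt_irrefl _ hlt
      obtain ⟨j₂, rfl⟩ : ∃ j₂, j₁ = Fin.succ j₂ := Fin.exists_succ_eq.mpr hj₁0 |>.imp fun _ h => h.symm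
      have hypart : ‖c j₂.succ‖ ≤ ‖∑ j, (c j.succ : PadicAlgCl p) * y j‖ := hy (fun j => c j.succ) j₂
      have hzpart : ‖(c 0 : PadicAlgCl p) * z‖ < ‖∑ j, (c j.succ : PadicAlgCl p) * y j‖ := by
        rw [norm_mul, PadicAlgCl.norm_extends]
        calc ‖c 0‖ * ‖z‖ ≤ ‖c 0‖ * 1 := by gcongr
          _ < ‖c j₂.succ‖ := by rw [mul_one]; exact hlt
          _ ≤ _ := hypart
      have : ‖w‖ = ‖∑ j, (c j.succ : PadicAlgCl p) * y j‖ := by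
        rw [hwsplit, IsUltrametricDist.norm_add_eq_max_of_norm_ne_norm hzpart.ne,
          max_eq_right hzpart.le]
      linarith
    have hCpos : 0 < ‖c j₁‖ := lt_of_le_of_lt (norm_nonneg _) hC
    have hc0pos : 0 < ‖c 0‖ := by rw [hc0]; exact hCpos
    have hc0ne : c 0 ≠ 0 := norm_pos_iff.mp hc0pos
    have hc0ne' : (c 0 : PadicAlgCl p) ≠ 0 := (map_ne_zero _).mpr hc0ne
    -- normalise: `z + Σ c' j y j` has norm `< 1`, `‖c' j‖ ≤ 1`
    set c' : Fin f₀ → ℚ_[p] := fun j => c j.succ / c 0 with hc'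
    have hc'1 : ∀ j, ‖c' j‖ ≤ 1 := fun j => by
      rw [hc', norm_div, div_le_one hc0pos, hc0]
      exact hj₁ _ (Finset.mem_univ _)
    have hsmall : ‖z + ∑ j, (c' j : PadicAlgCl p) * y j‖ < 1 := by
      have hrew : z + ∑ j, (c' j : PadicAlgCl p) * y j = (c 0 : PadicAlgCl p)⁻¹ * w := by
        rw [hwsplit, mul_add, ← mul_assoc, inv_mul_cancel₀ hc0ne', one_mul, Finset.mul_sum]
        congr 1
        refine Finset.sum_congr rfl fun j _ => ?_
        rw [hc', ← mul_assoc]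
        congr 1
        rw [map_div₀, div_eq_inv_mul]
      rw [hrew, norm_mul, norm_inv, PadicAlgCl.norm_extends, hc0,
        inv_mul_lt_iff₀ hCpos, mul_one]
      exact hC
    -- digits of `-c' j`
    have hdig : ∀ j, ∃ a : Fin p,
        ‖((-(c' j) : ℚ_[p]) : PadicAlgCl p) - ((a : ℕ) : PadicAlgCl p)‖ < 1 := by
      intro j
      obtain ⟨a, ha, h⟩ := exists_digit_norm_sub_lt_one (-(c' j)) (by rw [norm_neg]; exact hc'1 j)
      exact ⟨⟨a, ha⟩, h⟩
    choose a ha using hdig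
    refine ⟨a, ?_⟩
    have hrew : z - ∑ j, ((a j : ℕ) : PadicAlgCl p) * y j =
        (z + ∑ j, (c' j : PadicAlgCl p) * y j) +
          ∑ j, (((-(c' j) : ℚ_[p]) : PadicAlgCl p) - ((a j : ℕ) : PadicAlgCl p)) * y j := by
      rw [sub_eq_add_neg, add_assoc, ← Finset.sum_neg_distrib, ← Finset.sum_add_distrib]
      congr 1
      refine Finset.sum_congr rfl fun j _ => ?_
      rw [map_neg]
      ring
    rw [hrew]
    refine lt_of_le_of_lt (IsUltrametricDist.norm_add_le_max _ _) (max_lt hsmall ?_)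
    refine norm_sum_lt_of_forall_lt p _ _ one_pos fun j _ => ?_
    rw [norm_mul]
    calc ‖((-(c' j) : ℚ_[p]) : PadicAlgCl p) - ((a j : ℕ) : PadicAlgCl p)‖ * ‖y j‖
        ≤ ‖((-(c' j) : ℚ_[p]) : PadicAlgCl p) - ((a j : ℕ) : PadicAlgCl p)‖ * 1 := by
          gcongr; exact hy1 j
      _ < 1 := by rw [mul_one]; exact ha j
  -- pigeonhole on digit vectors
  choose D hD using fun i => hdigit (g i) (hgS i) (hg1 i)
  have hcard : Fintype.card (Fin f₀ → Fin p) < Fintype.card (Fin N) := by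
    simp only [Fintype.card_fun, Fintype.card_fin]
    calc p ^ f₀ ≤ p ^ (d / e) := Nat.pow_le_pow_right (Fact.out : p.Prime).pos hf₀le
      _ < N := hN
  obtain ⟨i, j, hij, hD'⟩ := Fintype.exists_ne_map_eq_of_card_lt D hcard
  refine ⟨i, j, hij, ?_⟩
  have hrew : g i - g j = (g i - ∑ k, ((D i k : ℕ) : PadicAlgCl p) * y k) -
      (g j - ∑ k, ((D j k : ℕ) : PadicAlgCl p) * y k) := by
    rw [hD']; ring
  rw [hrew, sub_eq_add_neg]
  refine lt_of_le_of_lt (IsUltrametricDist.norm_add_le_max _ _) (max_lt (hD i) ?_)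
  rw [norm_neg]
  exact hD j

end Literature.AnabelianGeometry.AbsoluteAnabelian.AbsTopIII

end
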